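import Summits.HodgeConjecture.Statement
import Summits.HodgeConjecture.HodgeConjecture.Theorems.WeilTypeLadder
import Summits.HodgeConjecture.HodgeConjecture.Theorems.WeilTypeLadderQuadraticVariational
import Summits.HodgeConjecture.HodgeConjecture.Theorems.WeilTypeLadderVariationalLocal
import Summits.HodgeConjecture.HodgeConjecture.Theorems.AnchorTransportVariationalHodgeTrivialFamily
import Summits.HodgeConjecture.HodgeConjecture.Theses.HeckePrymWeil
import Literature.AlgebraicGeometry.HodgeTheory.MotivatedClassesDeformationCurves
import Literature.AlgebraicGeometry.HodgeTheory.QuasiProjectiveOfAffine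
import Literature.AlgebraicGeometry.HodgeTheory.IsoTransport
import Literature.AlgebraicGeometry.Motives.AbelianVarietyProjectiveChart
import HarnessLib

/-!
# WeilTypeLadder · R∞var / R∞anc ON-PATH lemmas, the glue R∞ ⟸ R∞anc ∧ R∞var, and the LOCAL glue (prover 2)

For the quadratic leaves of `Theorems/WeilTypeLadderQuadraticVariational.lean`:

* `weilVariationalHodgeQuadratic_of_hodgeConjecture`, `anchoredWeilFamiliesQuadratic_of_hodgeConjecture` —
  ON-PATH lemmas (both leaves are cases of the summit; the anchor leaf via the constant family over `Spec ℂ`).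
* `weilVariationalHodgeQuadratic_of_weilVariationalHodge` — the route crux `HeckePrymWeil.WeilVariationalHodge`
  (stmt-HodgeConjecture-14497; all `(M,M)` classes, no quasi-projectivity) implies R∞var at `d = p` prime,
  `p ≡ 3 (4)`, `p ≥ 7` (the leaf generalises the crux's Weil-transport content to every `d`).
* `weilClassesImaginaryQuadratic_of_anchored_of_variational` — GLUE: R∞anc ∧ R∞var ⟹ R∞
  (`WeilClassesImaginaryQuadratic`; hence R2, R2₈, R1′, stmt-2524 and stmt-2522 by `WeilTypeLadderOnPath`).
* `weilVariationalHodgeQuadratic_of_local`, `weilClassesImaginaryQuadratic_of_anchored_of_local` — the LOCAL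
  engine interface (one algebraic fibre ⟹ a non-empty Euclidean-open set of algebraic fibres) suffices, by
  the base-generic Baire lemma `mem_algebraicClasses_of_isOpen_subset_algebraicityLocus`
  (`Theorems/WeilTypeLadderVariationalLocal.lean`).

Serves stmt-HodgeConjecture-14497. Sorry-free; no definition.
-/

-- every declaration of this problem lives in `Summit.HodgeConjecture.HodgeConjecture.…` (summit = sub-problem)
set_option linter.dupNamespace false

noncomputable section

open CategoryTheory AlgebraicGeometry

namespace Summit.HodgeConjecture.HodgeConjecture.WeilTypeLadder

open Literature.AlgebraicGeometry Literature.AlgebraicGeometry.Motives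
open Literature.AlgebraicGeometry.HodgeTheory
open Literature.AlgebraicTopology.SingularHomology
open Summit.HodgeConjecture.HodgeConjecture.Theorems
open Summit.HodgeConjecture.HodgeConjecture.Theses

/-! ### On-path lemmas -/

/-- **HC ⟹ R∞var** (fibrewise: `W|_{𝒳_s}` is a rational `(n,n)`-class on the smooth projective fibre).
[cite: CharlesSchnell2014Notes, Cor. 11.3.6 (p. 479)] -/
theorem weilVariationalHodgeQuadratic_of_hodgeConjecture (h : _root_.HodgeConjecture) :
    WeilVariationalHodgeQuadratic :=
  fun n _ _ _ _ _ _ hf _ _ _ _ _ hW _ _ s ↦ (h (hf.isSmoothProjective s)).2 n _ (hW s).1 (hW s).2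

/-- **HC ⟹ R∞anc**: the constant family `A.X ⟶ Spec ℂ` anchored at `A` itself (`c` algebraic by HC; fibre
inclusions are isomorphisms; `Spec ℂ` quasi-projective, smooth, irreducible; `A.X` projective). [folklore] -/
theorem anchoredWeilFamiliesQuadratic_of_hodgeConjecture (h : _root_.HodgeConjecture) :
    AnchoredWeilFamiliesQuadratic := by
  intro n _ d _ A φ hAdim hX hφ c hcQ hcH hc _
  have hfam : IsSmoothProjectiveFamily (toSpecOver A.X) (2 * n) := isSmoothProjectiveFamily_toSpecOver' hX
  let s : ComplexPoints (specOver ℂ ℂ) := 𝟙 (specOver ℂ ℂ)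
  haveI : ∀ t : ComplexPoints (specOver ℂ ℂ), IsIso (fiberι (toSpecOver A.X) t) :=
    fun t => isIso_fiberι_toSpecOver' (X := A.X) t
  let ι : A.X ≅ fiberOver (toSpecOver A.X) s := (asIso (fiberι (toSpecOver A.X) s)).symm
  have halg : c ∈ algebraicClasses A.X n := (h hX).2 n c hcQ hcH
  have hback : ∀ t : ComplexPoints (specOver ℂ ℂ),
      complexBetti.map (asIso (fiberι (toSpecOver A.X) t)).symm.hom (2 * n)
        (complexBetti.map (fiberι (toSpecOver A.X) t) (2 * n) c) = c := fun t => by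
    change (complexBetti.map (asIso (fiberι (toSpecOver A.X) t)).hom (2 * n) ≫
      complexBetti.map (asIso (fiberι (toSpecOver A.X) t)).inv (2 * n)) c = c
    rw [← complexBetti.map_comp, Iso.inv_hom_id, complexBetti.map_id]
    rfl
  refine ⟨A.X, specOver ℂ ℂ, toSpecOver A.X, s, s, ι, c, hfam,
    IsQuasiProjectiveOver.of_isProjectiveOver hX.isProjectiveOver, IsQuasiProjectiveOver.specOver,
    inferInstanceAs (IrreducibleSpace (PrimeSpectrum ℂ)), ?_, ?_, ?_, hback s, ?_⟩
  · haveI : IsIso (specOver ℂ ℂ).hom := by rw [specOver_hom_eq_id]; exact IsIso.id _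
    infer_instance
  · intro t
    exact ⟨hcQ.pullback _, IsOfHodgeType.map_of_iso (asIso (fiberι (toSpecOver A.X) t)) hcH⟩
  · intro t
    refine ⟨A, φ, (asIso (fiberι (toSpecOver A.X) t)).symm, hAdim, hφ, ?_⟩
    rw [hback t]
    exact hc
  · exact (mem_algebraicClasses_map_iff_of_iso (asIso (fiberι (toSpecOver A.X) s))).2 halg

/-! ### The route crux implies R∞var at the route's discriminants -/

/-- **`HeckePrymWeil.WeilVariationalHodge` ⟹ R∞var at `d = p` prime, `p ≡ 3 (4)`, `p ≥ 7`**: the crux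
transports ALL fibrewise-rational `(M,M)` global classes along smooth proper families of `√-p`-abelian
`2M`-folds over smooth irreducible bases; R∞var's charts supply the crux's fibre models
(`(p : ℤ) • 𝟙 = p • 𝟙`), and the quasi-projectivity hypotheses are simply dropped. [folklore] -/
theorem weilVariationalHodgeQuadratic_of_weilVariationalHodge (hV : HeckePrymWeil.WeilVariationalHodge)
    {p : ℕ} (hp : p.Prime) (hp4 : p % 4 = 3) (hp7 : 7 ≤ p) :
    ∀ (n : ℕ), 2 ≤ n →
      ∀ ⦃𝒳 S : Motives.SchemeOver ℂ⦄ (f : 𝒳 ⟶ S), Motives.IsSmoothProjectiveFamily f (2 * n) →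
        IsQuasiProjectiveOver 𝒳 → IsQuasiProjectiveOver S → IrreducibleSpace S.left →
        AlgebraicGeometry.Smooth S.hom →
        ∀ (W : complexBetti 𝒳 (2 * n)),
          (∀ s : Motives.ComplexPoints S,
            IsRationalClass (complexBetti.map (Motives.fiberι f s) (2 * n) W) ∧
              IsOfHodgeType (2 * n) (Motives.fiberOver f s) (2 * n) n n
                (complexBetti.map (Motives.fiberι f s) (2 * n) W)) →
          (∀ s : Motives.ComplexPoints S, ∃ (A' : Motives.AbelianVariety ℂ) (φ' : A' ⟶ A')
              (e' : A'.X ≅ Motives.fiberOver f s),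
            A'.dim = 2 * n ∧ φ' ≫ φ' = -(p • 𝟙 A') ∧
              complexBetti.map e'.hom (2 * n) (complexBetti.map (Motives.fiberι f s) (2 * n) W) ∈
                weilClassesOf A' φ' n p) →
          (∃ s₀ : Motives.ComplexPoints S,
            complexBetti.map (Motives.fiberι f s₀) (2 * n) W ∈
              algebraicClasses (Motives.fiberOver f s₀) n) →
          ∀ s : Motives.ComplexPoints S,
            complexBetti.map (Motives.fiberι f s) (2 * n) W ∈ algebraicClasses (Motives.fiberOver f s) n := by
  intro n hn 𝒳 S f hf _ _ hirr hsm W hW hWeil hs₀ s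
  refine hV p hp hp4 hp7 n (by omega) f hf hirr hsm W hW (fun t => ?_) hs₀ s
  obtain ⟨A', φ', e', hA', hφ', -⟩ := hWeil t
  refine ⟨A', φ', hA', ?_, ⟨e'⟩⟩
  rw [hφ', natCast_zsmul]

/-! ### Glue -/

/-- **GLUE: anchor supply and Weil-confined variational Hodge give Weil's question for every imaginary
quadratic `K`** — `AnchoredWeilFamiliesQuadratic → WeilVariationalHodgeQuadratic → WeilClassesImaginaryQuadratic`
(R∞; hence R2, R2₈, R1′ and stmt-2524 / stmt-2522 via `Theorems/WeilTypeLadderOnPath.lean`). For a rational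
`(n,n)` Weil class `c`: `c = 0` is trivial; otherwise take the anchored family through `c`, transport
algebraicity from `s₀` to `s₁` by R∞var, and read back through `ι`. [cite: Markman2025SecantWeil, Thm. 1.5.1 (strategy)] -/
theorem weilClassesImaginaryQuadratic_of_anchored_of_variational (hA : AnchoredWeilFamiliesQuadratic)
    (hV : WeilVariationalHodgeQuadratic) : WeilClassesImaginaryQuadratic := by
  intro n hn d hd A φ hAdim hX hφ c hcQ hcH hc
  by_cases hc0 : c = 0
  · rw [hc0]; exact Submodule.zero_mem _
  obtain ⟨𝒳, S, f, s₁, s₀, ι, W, hf, h𝒳, hS, hirrS, hsm, hW, hWeil, hread, hs₀⟩ :=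
    hA n hn d hd A φ hAdim hX hφ c hcQ hcH hc hc0
  haveI := hirrS
  have h1 : complexBetti.map (fiberι f s₁) (2 * n) W ∈ algebraicClasses (fiberOver f s₁) n :=
    hV n hn d hd f hf h𝒳 hS hirrS hsm W hW hWeil ⟨s₀, hs₀⟩ s₁
  rw [← hread]
  exact (mem_algebraicClasses_map_iff_of_iso ι).2 h1

/-! ### The LOCAL engine interface -/

/-- **R∞var ⟸ LOCAL-R∞var**: it suffices that one algebraic fibre force a NON-EMPTY EUCLIDEAN-OPEN set of
algebraic fibres (Baire + Charles–Schnell over the given smooth irreducible quasi-projective base,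
`mem_algebraicClasses_of_isOpen_subset_algebraicityLocus`). [cite: CharlesSchnell2014Notes, Prop. 11.3.11 (proof)] -/
theorem weilVariationalHodgeQuadratic_of_local
    (hloc : ∀ (n : ℕ), 2 ≤ n → ∀ (d : ℕ), 0 < d →
      ∀ ⦃𝒳 S : Motives.SchemeOver ℂ⦄ (f : 𝒳 ⟶ S), Motives.IsSmoothProjectiveFamily f (2 * n) →
        IsQuasiProjectiveOver 𝒳 → IsQuasiProjectiveOver S → IrreducibleSpace S.left →
        AlgebraicGeometry.Smooth S.hom →
        ∀ (W : complexBetti 𝒳 (2 * n)),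
          (∀ s : Motives.ComplexPoints S,
            IsRationalClass (complexBetti.map (Motives.fiberι f s) (2 * n) W) ∧
              IsOfHodgeType (2 * n) (Motives.fiberOver f s) (2 * n) n n
                (complexBetti.map (Motives.fiberι f s) (2 * n) W)) →
          (∀ s : Motives.ComplexPoints S, ∃ (A' : Motives.AbelianVariety ℂ) (φ' : A' ⟶ A')
              (e' : A'.X ≅ Motives.fiberOver f s),
            A'.dim = 2 * n ∧ φ' ≫ φ' = -(d • 𝟙 A') ∧
              complexBetti.map e'.hom (2 * n) (complexBetti.map (Motives.fiberι f s) (2 * n) W) ∈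
                weilClassesOf A' φ' n d) →
          (∃ s₀ : Motives.ComplexPoints S,
            complexBetti.map (Motives.fiberι f s₀) (2 * n) W ∈
              algebraicClasses (Motives.fiberOver f s₀) n) →
          ∃ U : Set (Motives.ComplexPoints S), IsOpen U ∧ U.Nonempty ∧
            ∀ t ∈ U, complexBetti.map (Motives.fiberι f t) (2 * n) W ∈
              algebraicClasses (Motives.fiberOver f t) n) :
    WeilVariationalHodgeQuadratic := by
  intro n hn d hd 𝒳 S f hf h𝒳 hS hirrS hsm W hW hWeil hs₀ s
  obtain ⟨U, hU, hUne, hUalg⟩ := hloc n hn d hd f hf h𝒳 hS hirrS hsm W hW hWeil hs₀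
  exact mem_algebraicClasses_of_isOpen_subset_algebraicityLocus f h𝒳 hS hsm hf W hU hUne hUalg s

/-- **Weil's question (imaginary quadratic `K`, every `n ≥ 2`, every `d`) from anchor supply and a LOCAL
transport engine** — R∞anc ∧ LOCAL-R∞var ⟹ R∞: Markman's programme (secant anchors + local deformation of a
semiregular sheaf) typed uniformly in `d` and `n`. [cite: Markman2025SecantWeil, Thm. 1.5.1 (strategy)]
[cite: CharlesSchnell2014Notes, Prop. 11.3.11 (proof)] -/
theorem weilClassesImaginaryQuadratic_of_anchored_of_local (hA : AnchoredWeilFamiliesQuadratic)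
    (hloc : ∀ (n : ℕ), 2 ≤ n → ∀ (d : ℕ), 0 < d →
      ∀ ⦃𝒳 S : Motives.SchemeOver ℂ⦄ (f : 𝒳 ⟶ S), Motives.IsSmoothProjectiveFamily f (2 * n) →
        IsQuasiProjectiveOver 𝒳 → IsQuasiProjectiveOver S → IrreducibleSpace S.left →
        AlgebraicGeometry.Smooth S.hom →
        ∀ (W : complexBetti 𝒳 (2 * n)),
          (∀ s : Motives.ComplexPoints S,
            IsRationalClass (complexBetti.map (Motives.fiberι f s) (2 * n) W) ∧
              IsOfHodgeType (2 * n) (Motives.fiberOver f s) (2 * n) n n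
                (complexBetti.map (Motives.fiberι f s) (2 * n) W)) →
          (∀ s : Motives.ComplexPoints S, ∃ (A' : Motives.AbelianVariety ℂ) (φ' : A' ⟶ A')
              (e' : A'.X ≅ Motives.fiberOver f s),
            A'.dim = 2 * n ∧ φ' ≫ φ' = -(d • 𝟙 A') ∧
              complexBetti.map e'.hom (2 * n) (complexBetti.map (Motives.fiberι f s) (2 * n) W) ∈
                weilClassesOf A' φ' n d) →
          (∃ s₀ : Motives.ComplexPoints S,
            complexBetti.map (Motives.fiberι f s₀) (2 * n) W ∈
              algebraicClasses (Motives.fiberOver f s₀) n) →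
          ∃ U : Set (Motives.ComplexPoints S), IsOpen U ∧ U.Nonempty ∧
            ∀ t ∈ U, complexBetti.map (Motives.fiberι f t) (2 * n) W ∈
              algebraicClasses (Motives.fiberOver f t) n) :
    WeilClassesImaginaryQuadratic :=
  weilClassesImaginaryQuadratic_of_anchored_of_variational hA (weilVariationalHodgeQuadratic_of_local hloc)

end Summit.HodgeConjecture.HodgeConjecture.WeilTypeLadder

end
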